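import Summits.Langlands.Langlands.Theses.SenNullAlignment
import HarnessLib

/-!
# LINE `split_SenNullAlignment` — crux stmt-Langlands-16308 `SenNullAlignment.SectorComplement`:
# the BC2 REDIRECT as a registered skeleton (4 stubs = the 4 children to be filed, composition proved)

Crux-strategist gen 1 (planner-cstrat-stmt-Langlands-16308-r1-0, 2026-08-17; RESTATED re-audit, human ruling
2026-08-16 21:1x).  The crux `SectorComplement := OddHilbertReciprocity → _root_.Langlands` is the route's junction
(`Langlands → SectorComplement` trivially).  This line is its TYPED DECOMPOSITION into four pieces cut along the seams of
the reciprocity conjecture OFF the route's sector, with the route target `X = OddHilbertReciprocity` LOAD-BEARING on the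
odd-Hilbert plane (it supplies the irreducible geometric avatar AND its local–global compatibility there, for its own
datum `RD₀`; the rigidity stub transports both to every pinned datum and every Satake-compatible frame):

* `stub_offPlaneReciprocityA` (P1, crux, OPEN) — direction (A) OFF the odd-Hilbert plane, rigid pair form, ∀ Rec;
* `stub_weakGeometricAutomorphy` (P2, crux, OPEN) — B_w, VERBATIM the shared item stmt-Langlands-17414;
* `stub_correspondenceRigidityGL2` (P3, support, theorem-level) — U + frame invariance + Henniart rec-rigidity at n = 2;
* `stub_canonicalReciprocityData` (P4, support, T0) — VERBATIM the shared item stmt-Langlands-17930.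

It SUPERSEDES the cut of `Lines/birth_SenNullAlignment.lean` (N / W⁺_off / LGC(all pairs, ∀Rec) / B_w / U), in which the
all-pairs LGC stub re-supplied local–global compatibility ON the plane and so left `X`'s LGC content idle; here nothing
off-the-shelf re-supplies it.  The same composition over TEXTS (landable under Theorems/, imports the Statement only) is
`Lines/split_SenNullAlignment_glue.lean`; per-piece BC3 skeletons are `Lines/birth_<Piece>.lean`; the census is
`STRATEGY-CENSUS.md`.  Probes: piece → Langlands / piece → SectorComplement FAILED 8/8 (exact?, aesop; combined
first|exact?|simpa|aesop fails by whnf-timeout), stub-of-piece probes FAILED 44/44.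

Disproof used: none exists for this crux (`ledger crux ls`: the shared `Disproof.lean` is the 18275/18745 siblings' file;
its only transferable content is `Langlands → C` / `¬C ↔ X ∧ ¬Langlands`, honoured: no stub is refuted by it).
References: [BuzzardGeeLMS2014] Conj. 3.2.1–3.2.2; [FontaineMazurGeometric1995] Conj. 1; [TaylorGaloisRepresentations2004]
Conj. 7; [DeligneSerreASENS1974] Lemme 3.2; [Henniarts1993] Thm 1.1; [HarrisTaylorAMS2001] Thm A.
-/

noncomputable section

set_option linter.dupNamespace false

namespace Summit.Langlands.Langlands.Cruxes.SectorComplement.SplitSenNullAlignment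

open scoped BigOperators Topology Classical Matrix NumberField MatrixGroups Polynomial
open Filter IsDedekindDomain
open Literature.NumberTheory.Automorphic Literature.NumberTheory.GaloisRepresentations
open Summit.Langlands
open Summit.Langlands.Langlands.Theses.SenNullAlignment (OddHilbertReciprocity SectorComplement)

/-! ## 1. The four stubs (the ONLY sorries of this file) = the four children of the split, verbatim -/

/-- **stub P1 — `OffPlaneReciprocityA`**: direction (A) OFF the odd-Hilbert plane, rigid pair form, for every pinned
datum (Buzzard–Gee Conj. 3.2.2 + irreducibility; Taylor Conj. 7 at every finite place; Deligne–Serre rigidity). OPEN.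
[cite: BuzzardGeeLMS2014, Conj. 3.2.2] [cite: TaylorGaloisRepresentations2004, Conj. 7] -/
theorem stub_offPlaneReciprocityA : ∀ (K : Type) [Field K] [NumberField K] (Rec : Summit.Langlands.ReciprocityData K) (n : ℕ) (hcpt : Literature.NumberTheory.Automorphic.isCompact_glFiniteIntegralLevel n K), 0 < n → ∀ (π : Literature.NumberTheory.Automorphic.CuspidalAutomorphicRepData n K hcpt), π.1.IsLAlgebraic → ¬ (NumberField.IsTotallyReal K ∧ n = 2 ∧ ∃ (k : (K →+* ℂ) → ℕ) (w : ℤ), π.1.HasInfinityType (fun β : K →+* ℂ => ({(⟨((k β : ℂ) - 1 - w) / 2, (1 - (k β : ℂ) - w) / 2, (k β : ℤ) - 1, by push_cast; ring⟩ : Literature.NumberTheory.Automorphic.ArchWeight), (⟨((k β : ℂ) - 1 - w) / 2, (1 - (k β : ℂ) - w) / 2, (k β : ℤ) - 1, by push_cast; ring⟩ : Literature.NumberTheory.Automorphic.ArchWeight).swap} : Multiset Literature.NumberTheory.Automorphic.ArchWeight)) ∧ (∀ (u : NumberField.InfinitePlace K), ∀ φ ∈ π.1.W, Literature.NumberTheory.Automorphic.rightTranslation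 (Literature.NumberTheory.Automorphic.AdelicGroupData.gl n K) (Matrix.GeneralLinearGroup.scalar (Fin n) (Units.map (MonoidHom.inl (NumberField.InfiniteAdeleRing K) (IsDedekindDomain.FiniteAdeleRing (NumberField.RingOfIntegers K) K) : NumberField.InfiniteAdeleRing K →* NumberField.AdeleRing (NumberField.RingOfIntegers K) K) (Units.map (MonoidHom.mulSingle (fun u' : NumberField.InfinitePlace K => u'.Completion) u : u.Completion →* NumberField.InfiniteAdeleRing K) (-1)))) φ + φ ∈ π.1.W')) → ∀ (ℓ : ℕ) [Fact ℓ.Prime] (ι : PadicAlgCl ℓ ≃+* ℂ), (∃ ρ : Literature.NumberTheory.GaloisRepresentations.FramedGaloisRep K (PadicAlgCl ℓ) n, ρ.toGaloisRep.IsIrreducible ∧ Summit.Langlands.IsGeometricFramed Rec ρ ∧ ∀ᶠ v : IsDedekindDomain.HeightOneSpectrum (NumberField.RingOfIntegers K) in Filter.cofinite, Summit.Langlands.SatakeFrobCompatibleAt ι π.1 ρ v) ∧ ∀ ρ : Literature.NumberTheory.GaloisRepresentations.FramedGaloisRep K (PadicAlgCl ℓ) n, ρ.toGaloisRep.IsIrreducible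 → Summit.Langlands.IsGeometricFramed Rec ρ → (∀ᶠ v : IsDedekindDomain.HeightOneSpectrum (NumberField.RingOfIntegers K) in Filter.cofinite, Summit.Langlands.SatakeFrobCompatibleAt ι π.1 ρ v) → (∀ v : IsDedekindDomain.HeightOneSpectrum (NumberField.RingOfIntegers K), Summit.Langlands.LocalGlobalCompatibleAt Rec ι π.1 ρ v) ∧ ∀ ρ' : Literature.NumberTheory.GaloisRepresentations.FramedGaloisRep K (PadicAlgCl ℓ) n, (∀ᶠ v : IsDedekindDomain.HeightOneSpectrum (NumberField.RingOfIntegers K) in Filter.cofinite, Summit.Langlands.SatakeFrobCompatibleAt ι π.1 ρ' v) → Summit.Langlands.IsConjugate ρ ρ' := by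
  sorry

/-- **stub P2 — `WeakGeometricAutomorphy`** (B_w; VERBATIM item stmt-Langlands-17414). OPEN.
[cite: FontaineMazurGeometric1995, Conj. 1] [cite: BuzzardGeeLMS2014, Conj. 3.2.2] -/
theorem stub_weakGeometricAutomorphy : ∀ (K : Type) [Field K] [NumberField K] (n : ℕ) (hcpt : Literature.NumberTheory.Automorphic.isCompact_glFiniteIntegralLevel n K), 0 < n → ∀ (ℓ : ℕ) [Fact ℓ.Prime] (ι : PadicAlgCl ℓ ≃+* ℂ) (ρ : Literature.NumberTheory.GaloisRepresentations.FramedGaloisRep K (PadicAlgCl ℓ) n), ρ.toGaloisRep.IsIrreducible → ((∀ᶠ v : IsDedekindDomain.HeightOneSpectrum (NumberField.RingOfIntegers K) in cofinite, ρ.IsUnramifiedAt v) ∧ ∀ (v : IsDedekindDomain.HeightOneSpectrum (NumberField.RingOfIntegers K)) (hv : ((ℓ : ℕ) : NumberField.RingOfIntegers K) ∈ v.asIdeal), (Literature.NumberTheory.PAdicHodge.fontainePstAdicCompletion v ℓ hv).IsDeRhamFramed (ρ.toLocal v)) → ∃ π : Literature.NumberTheory.Automorphic.CuspidalAutomorphicRepData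 n K hcpt, π.1.IsLAlgebraic ∧ ∀ᶠ v : IsDedekindDomain.HeightOneSpectrum (NumberField.RingOfIntegers K) in cofinite, SatakeFrobCompatibleAt ι π.1 ρ v := by
  sorry

/-- **stub P3 — `CorrespondenceRigidityGL2`**: rigidity of the GL₂ correspondence across pinned data and frames
(Chebotarev + Brauer–Nesbitt; frame invariance; Henniart 1993 Thm 1.1 through the pins). Theorem-level.
[cite: Henniarts1993, Thm 1.1] [cite: DeligneSerreASENS1974, Lemme 3.2] -/
theorem stub_correspondenceRigidityGL2 : ∀ (K : Type) [Field K] [NumberField K] (Rec Rec' : Summit.Langlands.ReciprocityData K) (hcpt : Literature.NumberTheory.Automorphic.isCompact_glFiniteIntegralLevel 2 K) (π : Literature.NumberTheory.Automorphic.CuspidalAutomorphicRepData 2 K hcpt) (ℓ : ℕ) [Fact ℓ.Prime] (ι : PadicAlgCl ℓ ≃+* ℂ) (ρ ρ' : Literature.NumberTheory.GaloisRepresentations.FramedGaloisRep K (PadicAlgCl ℓ) 2), ρ.toGaloisRep.IsIrreducible → Summit.Langlands.Corresponds Rec ι π.1 ρ → (∀ᶠ v : IsDedekindDomain.HeightOneSpectrum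 (NumberField.RingOfIntegers K) in Filter.cofinite, Summit.Langlands.SatakeFrobCompatibleAt ι π.1 ρ' v) → Summit.Langlands.IsConjugate ρ ρ' ∧ Summit.Langlands.Corresponds Rec' ι π.1 ρ' := by
  sorry

/-- **stub P4 — `CanonicalReciprocityData`** (the summit's non-vacuity conjunct; VERBATIM item stmt-Langlands-17930).
T0 literature debt. [cite: HarrisTaylorAMS2001, Thm. A] [cite: HenniartInventiones2000, Thm. 1.2] -/
theorem stub_canonicalReciprocityData : ∀ (F : Type) [Field F] [NumberField F], Nonempty (Summit.Langlands.ReciprocityData F) := by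
  sorry

/-! ## 2. The stub statements as named propositions -/

namespace _Goal

/-- The statement of `stub_offPlaneReciprocityA` (literally its type). [folklore] -/
def stub_offPlaneReciprocityA : Prop :=
  type_of% @Summit.Langlands.Langlands.Cruxes.SectorComplement.SplitSenNullAlignment.stub_offPlaneReciprocityA

/-- The statement of `stub_weakGeometricAutomorphy` (literally its type). [folklore] -/
def stub_weakGeometricAutomorphy : Prop :=
  type_of% @Summit.Langlands.Langlands.Cruxes.SectorComplement.SplitSenNullAlignment.stub_weakGeometricAutomorphy

/-- The statement of `stub_correspondenceRigidityGL2` (literally its type). [folklore] -/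
def stub_correspondenceRigidityGL2 : Prop :=
  type_of% @Summit.Langlands.Langlands.Cruxes.SectorComplement.SplitSenNullAlignment.stub_correspondenceRigidityGL2

/-- The statement of `stub_canonicalReciprocityData` (literally its type). [folklore] -/
def stub_canonicalReciprocityData : Prop :=
  type_of% @Summit.Langlands.Langlands.Cruxes.SectorComplement.SplitSenNullAlignment.stub_canonicalReciprocityData

end _Goal

/-! ## 3. The composition (kernel-checked, no `sorry`) -/

/-- **`SectorComplement` from its four pieces** (pure logic).  Given `X` and `K, Rec, n, hcpt`: non-vacuity = P4;
(A) ON the odd-Hilbert plane: `X` gives `RD₀` and the irreducible geometric `ρ_π` with `Corresponds RD₀ ι π ρ_π`, P3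
transports it to `Rec` and gives uniqueness; (A) OFF the plane: P1; (B): P2 gives `π`, completed ON the plane by `X` + P3
and OFF it by the pair half of P1.  Hypotheses = the four stub statements by name; conclusion = the route decl by name.
[cite: BuzzardGeeLMS2014, Conj. 3.2.1 and Conj. 3.2.2] [cite: FontaineMazurGeometric1995, Conj. 1] -/
theorem SectorComplement_of (hA : _Goal.stub_offPlaneReciprocityA) (hB : _Goal.stub_weakGeometricAutomorphy)
    (hR : _Goal.stub_correspondenceRigidityGL2) (hN : _Goal.stub_canonicalReciprocityData) : SectorComplement := by
  dsimp only [_Goal.stub_offPlaneReciprocityA, _Goal.stub_weakGeometricAutomorphy, _Goal.stub_correspondenceRigidityGL2,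
    _Goal.stub_canonicalReciprocityData] at hA hB hR hN
  intro hX K _ _
  refine ⟨hN K, fun Rec n hn hcpt => ⟨?_, ?_⟩⟩
  · -- (A) automorphic → Galois, for every `Rec`
    intro π hLalg ℓ _ ι
    by_cases hplane : (NumberField.IsTotallyReal K ∧ n = 2 ∧ ∃ (k : (K →+* ℂ) → ℕ) (w : ℤ), π.1.HasInfinityType (fun β : K →+* ℂ => ({(⟨((k β : ℂ) - 1 - w) / 2, (1 - (k β : ℂ) - w) / 2, (k β : ℤ) - 1, by push_cast; ring⟩ : Literature.NumberTheory.Automorphic.ArchWeight), (⟨((k β : ℂ) - 1 - w) / 2, (1 - (k β : ℂ) - w) / 2, (k β : ℤ) - 1, by push_cast; ring⟩ : Literature.NumberTheory.Automorphic.ArchWeight).swap} : Multiset Literature.NumberTheory.Automorphic.ArchWeight)) ∧ (∀ (u : NumberField.InfinitePlace K), ∀ φ ∈ π.1.W, Literature.NumberTheory.Automorphic.rightTranslation (Literature.NumberTheory.Automorphic.AdelicGroupData.gl n K) (Matrix.GeneralLinearGroup.scalar (Fin n) (Units.map (MonoidHom.inl (NumberField.InfiniteAdeleRing K) (IsDedekindDomain.FiniteAdeleRing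 (NumberField.RingOfIntegers K) K) : NumberField.InfiniteAdeleRing K →* NumberField.AdeleRing (NumberField.RingOfIntegers K) K) (Units.map (MonoidHom.mulSingle (fun u' : NumberField.InfinitePlace K => u'.Completion) u : u.Completion →* NumberField.InfiniteAdeleRing K) (-1)))) φ + φ ∈ π.1.W'))
    · obtain ⟨hK, hn2, k, w, hhol, hodd⟩ := hplane
      subst hn2
      obtain ⟨RD₀, hRD₀⟩ := hX K hK
      obtain ⟨ρ, hirr, hgeo, hcorr⟩ := hRD₀ hcpt π k w hLalg hhol hodd ℓ ι
      refine ⟨ρ, hirr, hgeo, (hR K RD₀ Rec hcpt π ℓ ι ρ ρ hirr hcorr hcorr.1).2, fun ρ' hcorr' => ?_⟩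
      exact (hR K RD₀ Rec hcpt π ℓ ι ρ ρ' hirr hcorr hcorr'.1).1
    · obtain ⟨⟨ρ, hirr, hgeo, hsat⟩, hpair⟩ := hA K Rec n hcpt hn π hLalg hplane ℓ ι
      obtain ⟨hlgc, huniq⟩ := hpair ρ hirr hgeo hsat
      exact ⟨ρ, hirr, hgeo, ⟨hsat, hlgc⟩, fun ρ' hcorr' => huniq ρ' hcorr'.1⟩
  · -- (B) Galois → automorphic, for every `Rec`
    intro ℓ _ ι ρ hirr hgeo
    obtain ⟨π, hLalg, hsat⟩ := hB K n hcpt hn ℓ ι ρ hirr hgeo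
    refine ⟨π, hLalg, ?_⟩
    by_cases hplane : (NumberField.IsTotallyReal K ∧ n = 2 ∧ ∃ (k : (K →+* ℂ) → ℕ) (w : ℤ), π.1.HasInfinityType (fun β : K →+* ℂ => ({(⟨((k β : ℂ) - 1 - w) / 2, (1 - (k β : ℂ) - w) / 2, (k β : ℤ) - 1, by push_cast; ring⟩ : Literature.NumberTheory.Automorphic.ArchWeight), (⟨((k β : ℂ) - 1 - w) / 2, (1 - (k β : ℂ) - w) / 2, (k β : ℤ) - 1, by push_cast; ring⟩ : Literature.NumberTheory.Automorphic.ArchWeight).swap} : Multiset Literature.NumberTheory.Automorphic.ArchWeight)) ∧ (∀ (u : NumberField.InfinitePlace K), ∀ φ ∈ π.1.W, Literature.NumberTheory.Automorphic.rightTranslation (Literature.NumberTheory.Automorphic.AdelicGroupData.gl n K) (Matrix.GeneralLinearGroup.scalar (Fin n) (Units.map (MonoidHom.inl (NumberField.InfiniteAdeleRing K) (IsDedekindDomain.FiniteAdeleRing (NumberField.RingOfIntegers K) K) : NumberField.InfiniteAdeleRing K →* NumberField.AdeleRing (NumberField.RingOfIntegers K) K) (Units.map (MonoidHom.mulSingle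 (fun u' : NumberField.InfinitePlace K => u'.Completion) u : u.Completion →* NumberField.InfiniteAdeleRing K) (-1)))) φ + φ ∈ π.1.W'))
    · obtain ⟨hK, hn2, k, w, hhol, hodd⟩ := hplane
      subst hn2
      obtain ⟨RD₀, hRD₀⟩ := hX K hK
      obtain ⟨ρ₁, hirr₁, -, hcorr₁⟩ := hRD₀ hcpt π k w hLalg hhol hodd ℓ ι
      exact (hR K RD₀ Rec hcpt π ℓ ι ρ₁ ρ hirr₁ hcorr₁ hsat).2
    · obtain ⟨-, hpair⟩ := hA K Rec n hcpt hn π hLalg hplane ℓ ι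
      exact ⟨hsat, (hpair ρ hirr hgeo hsat).1⟩

/-- By-name sanity check: the four stubs feed the composition as they stand. -/
example : SectorComplement :=
  SectorComplement_of stub_offPlaneReciprocityA stub_weakGeometricAutomorphy stub_correspondenceRigidityGL2
    stub_canonicalReciprocityData

/-- The junction is implied by the summit (target-equivalent by design; recorded as an `example`). -/
example (h : _root_.Langlands) : SectorComplement :=
  fun _ => h

end Summit.Langlands.Langlands.Cruxes.SectorComplement.SplitSenNullAlignment

end
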